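import Literature.MathematicalPhysics.QuantumLattice.DWaveSourceEnergyDensityLimit
import Literature.MathematicalPhysics.QuantumLattice.DWaveSourceLeeYang
import HarnessLib

/-!
# The sourced ground energy is EVEN in the `d`-wave source, and `d`-wave order is exactly
# NON-DIFFERENTIABILITY of the thermodynamic-limit sourced energy density at `h = 0`

Topic `Literature/MathematicalPhysics/QuantumLattice` (namespace = path). Proof-only companion of
`DWaveSourceEnergyDensityLimit.lean` (the cusp identity `dWaveOrderParameter U μ = −½∂⁺g(0)` for the
pair-sourced grand-canonical Hubbard torus `dWaveSourceTorus L U μ h = H(1,U) − μN − h(Δ_d + Δ_d†)`) and of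
`DWaveSourceLeeYang.lean` / `DWaveSourceTorusJointPressureEven.lean` (evenness of the sourced PARTITION
FUNCTION in `h` by the gauge rotation `e^{iπN/2}`). Hubbard ladder, rung CQ, rows PC-a/PC-c. No definition,
no named fact, no `sorry`; zero compute.

## Contents

* `groundEnergy_dWaveSourceTorus_neg`: `E₀(dWaveSourceTorus L U μ (−h)) = E₀(dWaveSourceTorus L U μ h)` for
  every real `h` — the unitary gauge rotation `W = e^{iπN/2}` commutes with `H(1,U) − μN` and maps
  `Δ_d ↦ −Δ_d` (the pair field lowers `N` by `2`), so `W A_L(h) W⁻¹ = A_L(−h)`; the spectrum, hence the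
  ground energy, is invariant (the tree's grading lemmas `conj_eq_smul_of_grading`,
  `diagonal_card_commutator_*`).
* CONDITIONAL on the thermodynamic limit at every real source, `E_{L+1}(h)/(L+1)² → g(h)` for all `h`
  (hypothesis `hg`; existence not in the tree): `g` is even (`even_of_tendsto_groundEnergy_dWaveSource`); the
  one-sided slopes of `g` at `0` converge to `∓2·dWaveOrderParameter U μ`
  (`tendsto_slope_nhdsGT_zero_dWaveSource`, `tendsto_slope_nhdsLT_zero_dWaveSource`); hence
  `HasDerivAt g g′ 0 ↔ g′ = 0 ∧ dWaveOrderParameter U μ = 0` (`hasDerivAt_zero_iff_dWaveOrderParameter_eq_zero`)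
  and THE LITERAL FORM OF «PC-c = PC-a»:
  `HasDWaveOrder U μ ↔ ¬ DifferentiableAt ℝ g 0` (`hasDWaveOrder_iff_not_differentiableAt_zero`) —
  Koma–Tasaki `d`-wave order is exactly a kink of the (even, concave near `0⁺`) sourced energy density at
  zero source.

## What is NOT here

* Existence of `g`; oddness of the sourced pair density `m_L(−h) = −m_L(h)` (true, not needed here);
  anything about long-range order.

## References

* T. Koma, H. Tasaki, J. Stat. Phys. 76 (1994) 745–803, §1 (order parameter from the sourced Hamiltonian;
  `U(1)` gauge rotations). [cite: KomaTasaki1994, §1]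
* R. B. Griffiths, Phys. Rev. 152 (1966) 240–246, §II (one-sided derivatives of the limiting energy and
  the order parameter). [cite: Griffiths1966, §II]
-/

noncomputable section

namespace Literature.MathematicalPhysics.QuantumLattice

open Matrix Filter Set Literature.Probability.LatticeModels
open scoped Topology

/-! ### Similarity invariance of the ground energy -/

section Similarity

variable {m : Type*} [Fintype m] [DecidableEq m]

/-- `E₀(W A W′) = E₀(A)` whenever `W W′ = 1` (the spectrum is invariant under conjugation by a unit,
Mathlib `spectrum.units_conjugate`). [folklore] -/
private theorem groundEnergy_conj_of_mul_eq_one {A W W' : Matrix m m ℂ} (hWW' : W * W' = 1)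
    (hW'W : W' * W = 1) : (W * A * W').groundEnergy = A.groundEnergy := by
  set u : (Matrix m m ℂ)ˣ := ⟨W, W', hWW', hW'W⟩
  have hspec : spectrum ℂ (W * A * W') = spectrum ℂ A := spectrum.units_conjugate (u := u)
  unfold Matrix.groundEnergy ContinuousLinearMap.groundEnergy
  rw [spectrum_toEuclideanCLM, spectrum_toEuclideanCLM, hspec]

end Similarity

/-! ### Evenness of the sourced ground energy in the source -/

section Even

variable (L : ℕ) [NeZero L]

/-- **The sourced ground energy is even in the source**:
`E₀(dWaveSourceTorus L U μ (−h)) = E₀(dWaveSourceTorus L U μ h)` for every real `h` (gauge rotation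
`e^{iπN/2}`: `N` commutes with `H(1,U) − μN` and `[N, Δ_d] = −2Δ_d`, so the rotation flips the sign of the
source and preserves the spectrum). [cite: KomaTasaki1994, §1] -/
theorem groundEnergy_dWaveSourceTorus_neg (U μ h : ℝ) :
    (dWaveSourceTorus L U μ (-h)).groundEnergy = (dWaveSourceTorus L U μ h).groundEnergy := by
  set d : Finset (Orb (FermionTorus 2 L)) → ℂ := fun s => (s.card : ℂ) with hd
  set c : ℂ := (Real.pi : ℂ) / 2 * Complex.I with hc
  set W : Matrix (Finset (Orb (FermionTorus 2 L))) (Finset (Orb (FermionTorus 2 L))) ℂ :=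
    diagonal fun s => Complex.exp (c * d s) with hW
  set W' : Matrix (Finset (Orb (FermionTorus 2 L))) (Finset (Orb (FermionTorus 2 L))) ℂ :=
    diagonal fun s => Complex.exp (-(c * d s)) with hW'
  have hWW' : W * W' = 1 := diagonal_exp_mul_diagonal_exp_neg d c
  have hW'W : W' * W = 1 := by
    rw [hW, hW', diagonal_mul_diagonal, ← diagonal_one]
    congr 1
    funext s
    rw [← Complex.exp_add, neg_add_cancel, Complex.exp_zero]
  have hc2 : Complex.exp (c * 2) = -1 := by
    rw [hc, show (Real.pi : ℂ) / 2 * Complex.I * 2 = Real.pi * Complex.I by ring]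
    exact Complex.exp_pi_mul_I
  have hcm2 : Complex.exp (c * -2) = -1 := by
    have h1 : Complex.exp (c * -2) * Complex.exp (c * 2) = 1 := by
      rw [← Complex.exp_add]
      ring_nf
      exact Complex.exp_zero
    rw [hc2] at h1
    linear_combination -h1
  -- the rotation fixes `H(1,U) − μN` …
  have hcH : W * hubbardTorusWith 2 L 1 U μ * W' = hubbardTorusWith 2 L 1 U μ := by
    have key := conj_eq_smul_of_grading d (A := hubbardTorusWith 2 L 1 U μ) (q := 0)
      (by simpa using diagonal_card_commutator_hubbardTorusWith L U μ) c
    rw [hW, hW', key]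
    simp
  -- … and flips the source `Δ_d + Δ_d†`
  have hcQ : W * (pairField dWaveFormFactor L + (pairField dWaveFormFactor L)ᴴ) * W' =
      -(pairField dWaveFormFactor L + (pairField dWaveFormFactor L)ᴴ) := by
    rw [hW, hW', Matrix.mul_add, Matrix.add_mul,
      conj_eq_smul_of_grading d (diagonal_card_commutator_pairField L) c,
      conj_eq_smul_of_grading d (diagonal_card_commutator_pairField_conjTranspose L) c, hcm2, hc2,
      neg_one_smul, neg_one_smul, neg_add]
  have hconj : W * dWaveSourceTorus L U μ h * W' = dWaveSourceTorus L U μ (-h) := by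
    rw [dWaveSourceTorus_eq, dWaveSourceTorus_eq, Matrix.mul_sub, Matrix.sub_mul, hcH, Matrix.mul_smul,
      Matrix.smul_mul, hcQ, Complex.ofReal_neg, smul_neg, neg_smul]
  rw [← hconj, groundEnergy_conj_of_mul_eq_one hWW' hW'W]

end Even

/-! ### Thermodynamic limit at every real source: `g` is even, and order = non-differentiability at `0` -/

section TwoSided

variable (U μ : ℝ)

/-- IF `E_{L+1}(h)/(L+1)² → g(h)` for every real `h`, THEN `g(−h) = g(h)`. [cite: KomaTasaki1994, §1] -/
theorem even_of_tendsto_groundEnergy_dWaveSource {g : ℝ → ℝ}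
    (hg : ∀ h : ℝ, Tendsto (fun L : ℕ =>
      (dWaveSourceTorus (L + 1) U μ h).groundEnergy / (((L + 1 : ℕ) : ℝ)) ^ 2) atTop (𝓝 (g h)))
    (h : ℝ) : g (-h) = g h := by
  refine tendsto_nhds_unique (hg (-h)) ?_
  simp only [groundEnergy_dWaveSourceTorus_neg]
  exact hg h

/-- The RIGHT slope of the limit energy at `0` tends to `−2·dWaveOrderParameter U μ` (the cusp identity,
limits on `[0,∞)` suffice). [cite: Griffiths1966, §II] -/
theorem tendsto_slope_nhdsGT_zero_dWaveSource {g : ℝ → ℝ}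
    (hg : ∀ h : ℝ, 0 ≤ h → Tendsto (fun L : ℕ =>
      (dWaveSourceTorus (L + 1) U μ h).groundEnergy / (((L + 1 : ℕ) : ℝ)) ^ 2) atTop (𝓝 (g h))) :
    Tendsto (slope g 0) (𝓝[>] 0) (𝓝 (-2 * dWaveOrderParameter U μ)) := by
  have key := (tendsto_slope_nhdsGT_dWaveOrderParameter U μ hg).const_mul (-2)
  refine key.congr' ?_
  filter_upwards [self_mem_nhdsWithin] with h hh
  have hh' : (0 : ℝ) < h := hh
  rw [slope_def_field, sub_zero]
  field_simp
  ring

/-- The LEFT slope of the limit energy at `0` tends to `+2·dWaveOrderParameter U μ` (evenness).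
[cite: Griffiths1966, §II] -/
theorem tendsto_slope_nhdsLT_zero_dWaveSource {g : ℝ → ℝ}
    (hg : ∀ h : ℝ, Tendsto (fun L : ℕ =>
      (dWaveSourceTorus (L + 1) U μ h).groundEnergy / (((L + 1 : ℕ) : ℝ)) ^ 2) atTop (𝓝 (g h))) :
    Tendsto (slope g 0) (𝓝[<] 0) (𝓝 (2 * dWaveOrderParameter U μ)) := by
  have hneg : Tendsto (fun h : ℝ => -h) (𝓝[<] (0 : ℝ)) (𝓝[>] (0 : ℝ)) := by
    simpa using (tendsto_neg_nhdsLT (a := (0 : ℝ)))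
  have key := ((tendsto_slope_nhdsGT_dWaveOrderParameter U μ fun h _ => hg h).comp hneg).const_mul 2
  refine key.congr' ?_
  filter_upwards [self_mem_nhdsWithin] with h hh
  have hh' : h < 0 := hh
  have hne : h ≠ 0 := hh'.ne
  rw [slope_def_field, sub_zero, Function.comp_apply,
    even_of_tendsto_groundEnergy_dWaveSource U μ hg h]
  field_simp
  ring

/-- **Differentiability at zero source = no order**: IF `E_{L+1}(h)/(L+1)² → g(h)` for every real `h`,
THEN `HasDerivAt g g′ 0 ↔ g′ = 0 ∧ dWaveOrderParameter U μ = 0`. [cite: Griffiths1966, §II] -/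
theorem hasDerivAt_zero_iff_dWaveOrderParameter_eq_zero {g : ℝ → ℝ}
    (hg : ∀ h : ℝ, Tendsto (fun L : ℕ =>
      (dWaveSourceTorus (L + 1) U μ h).groundEnergy / (((L + 1 : ℕ) : ℝ)) ^ 2) atTop (𝓝 (g h)))
    {g' : ℝ} : HasDerivAt g g' 0 ↔ g' = 0 ∧ dWaveOrderParameter U μ = 0 := by
  have hL := tendsto_slope_nhdsLT_zero_dWaveSource U μ hg
  have hR := tendsto_slope_nhdsGT_zero_dWaveSource U μ fun h _ => hg h
  rw [hasDerivAt_iff_tendsto_slope_left_right]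
  constructor
  · rintro ⟨hl, hr⟩
    have h1 := tendsto_nhds_unique hl hL
    have h2 := tendsto_nhds_unique hr hR
    constructor <;> linarith
  · rintro ⟨rfl, h0⟩
    rw [h0, mul_zero] at hL hR
    exact ⟨hL, hR⟩

/-- **`d`-wave order IS non-differentiability of the sourced energy density at zero source** (the literal
form of "PC-c = PC-a"): IF `E_{L+1}(h)/(L+1)² → g(h)` for every real `h`, THEN
`HasDWaveOrder U μ ↔ ¬ DifferentiableAt ℝ g 0`. [cite: KomaTasaki1994, §1] -/
theorem hasDWaveOrder_iff_not_differentiableAt_zero {g : ℝ → ℝ}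
    (hg : ∀ h : ℝ, Tendsto (fun L : ℕ =>
      (dWaveSourceTorus (L + 1) U μ h).groundEnergy / (((L + 1 : ℕ) : ℝ)) ^ 2) atTop (𝓝 (g h))) :
    HasDWaveOrder U μ ↔ ¬ DifferentiableAt ℝ g 0 := by
  rw [hasDWaveOrder_iff]
  constructor
  · intro hpos hd
    have h0 := ((hasDerivAt_zero_iff_dWaveOrderParameter_eq_zero U μ hg).1 hd.hasDerivAt).2
    exact hpos.ne' h0
  · intro hnd
    rcases (dWaveOrderParameter_nonneg U μ).eq_or_lt with h0 | hpos
    · exact absurd ((hasDerivAt_zero_iff_dWaveOrderParameter_eq_zero U μ hg).2 ⟨rfl, h0.symm⟩).differentiableAt hnd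
    · exact hpos

/-- Equivalently: no `d`-wave order iff the sourced energy density is differentiable at zero source, and
then its derivative there is `0`. [cite: KomaTasaki1994, §1] -/
theorem not_hasDWaveOrder_iff_hasDerivAt_zero {g : ℝ → ℝ}
    (hg : ∀ h : ℝ, Tendsto (fun L : ℕ =>
      (dWaveSourceTorus (L + 1) U μ h).groundEnergy / (((L + 1 : ℕ) : ℝ)) ^ 2) atTop (𝓝 (g h))) :
    ¬ HasDWaveOrder U μ ↔ HasDerivAt g 0 0 := by
  rw [hasDerivAt_zero_iff_dWaveOrderParameter_eq_zero U μ hg, hasDWaveOrder_iff, not_lt]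
  constructor
  · intro hle
    exact ⟨rfl, le_antisymm hle (dWaveOrderParameter_nonneg U μ)⟩
  · rintro ⟨-, h0⟩
    exact h0.le

end TwoSided

end Literature.MathematicalPhysics.QuantumLattice

end
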